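import Mathlib
import Literature.MathematicalPhysics.QuantumFieldTheory.Balaban1983to89.B13Resummation

/-!
# `Balaban1983to89.B13Ineq240` — T. Bałaban, *Renormalization group approach to lattice gauge field theories.
II. Cluster expansions*, Commun. Math. Phys. **116** (1988) 1–22 [Balaban1988RG2Cluster]: the display (2.40) p. 21
AS PRINTED, and the sentence after it (*"The last sum is bounded by … is bounded by 1. This yields (2.41)"*) PROVED from
the paper's own geometric inputs (1.26) and (2.30), with the printed O(1) of (2.41) made explicit

statement-level skeleton of published theorems with citation tags; proofs where landed; nothing here is a claim about
the Yang–Mills mass gap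

PDF held: `paper:balaban1988-cmp116-rg-ii-cluster` (journal page = PDF page); the passage was read as an image on the
×2 render `run/shared/lean/pub/pub-balaban/b2b-balaban-ref1/pages/1988-cmp116-rg-II-cluster/1988-cmp116-rg-II-cluster-p021-x2.png`
(this unit, 2026-08-21).

CITATION HEADER / WHAT IS REPRODUCED (unit `lit-balaban-r10` gen 3 = the B13 reader/fold owner; SKELETON row
`B13.Eq2.40`, `absent (printed [26]-route) · proved-existing (KP substitute)` at SKELETON v3.19, 4th of the ABSENT
free-target board of DEPGRAPH v8 §2e.2 with 262 transitive dependants).  P. 21 [PDF 21], verbatim: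
*"To the above sum we can repeat all the considerations and bounds of the paper [26], for κ sufficiently large, and ε₁
sufficiently small. We obtain*
  `|𝐄^{(k+1)}(X)| ≦ exp(−(1 − 9δ)½Lκd_{k+1}(X)) exp(−5κ) · Σ_{Z⊂X} C₃ε₁ exp 5κ exp(−½δLκd_{k+1}(Z)) O(1) exp 2(LM)⁻⁴|Z|.` (2.40)
*The last sum is bounded by C₃ε₁ exp 5κO(1)(LM)⁻⁴|X| ≦ C₃ε₁ exp 5κO(1) exp(LM)⁻⁴|X|, and the last exponential
multiplied by exp(−½δLκd_{k+1}(X)) is bounded by 1. This yields* `|𝐄^{(k+1)}(X)| ≦ O(1)C₃ε₁ exp(−(1 − 10δ)½Lκd_{k+1}(X)).`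
(2.41)"

WHAT THIS MODULE TYPES AND PROVES (over the abstract one-step carrier `B13.StepData` of the sibling `…Balaban1983to89.B13`
— `Dk1` = 𝐃_{k+1} with `dj` = d_{k+1}, `sp2 X` = Uᶜ_{k+1}(X, α₀, α₁), `Ek1` = 𝐄^{(k+1)} — and the footprint map
`cubes : 𝐃_{k+1} → Finset Cube` of the siblings `B13FamilySum`/`B13Resummation`: `(cubes Z).card` = (LM)⁻⁴|Z| = the number
of LM-cubes of Z, `B13FamilySum.inside univ cubes (cubes X)` = the index set *"Z ⊂ X"* of (2.40)):
* §1 `term240`, `lastSum240`, `Ineq240` — (2.40) AS PRINTED (`O₁` = its printed O(1); `C₃` = the activity constant of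
  Lemma 3, `B13.Consts.C3act`).  A `Prop`; the [26]-route (2.39) ⇒ (2.40) (*"repeat all the considerations and bounds of
  the paper [26]"*, [26] = Cammarota, CMP 85 (1982)) stays BY REFERENCE — the tree's kernel SUBSTITUTE for (2.39) ⇒ (2.41)
  is the Kotecký–Preiss route of `B13Resummation` (cell GAPS G-B13-11), not re-derived here.
* §2 `term240_le`, `anchoredSum240_le`, **`lastSum240_le`** — the first clause *"The last sum is bounded by
  C₃ε₁ exp 5κO(1)(LM)⁻⁴|X|"* PROVED, with its O(1) EXPLICIT (`O₁·e^{2c₁}·K₀`), from the two geometric inputs the paper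
  has in hand at this point, in the typed shapes of `B13FamilySum`: (1.26) p. 8 at scale k + 1 (`Ineq126 univ cubes d κ₀ K₀`:
  Σ_{Z∋□} e^{−κ₀d(Z)} ≤ K₀) and the volume law (2.30) p. 18 in its REPAIRED additive form (`VolBound univ cubes d c₁`:
  (LM)⁻⁴|Z| ≤ c₁(1 + d_{k+1}(Z)); the printed lower half of (2.30) is false for degenerate domains, cell GAPS G-B13-07), under
  *"κ sufficiently large"* made explicit as `κ₀ + 2c₁ ≤ ½δLκ`: every Z ⊂ X contains a cube of X, so Σ_{Z⊂X} ≤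
  Σ_{□⊂X} Σ_{Z∋□} (`sum_inside_le_sum_anchored`), and e^{2(LM)⁻⁴|Z|} ≤ e^{2c₁}e^{2c₁d(Z)} is paid from the rate.
* §3 `card_le_exp_card` — the printed *"(LM)⁻⁴|X| ≦ exp(LM)⁻⁴|X|"*; **`not_absorb_printed`** — the printed clause *"the
  last exponential multiplied by exp(−½δLκd_{k+1}(X)) is bounded by 1"* FAILS AS PRINTED for every domain with
  d_{k+1}(X) = 0 (a single LM-cube: e¹·e⁰ = e > 1) — the same degenerate-domain slip as the lower half of (2.30)
  (GAPS G-B13-07), harmless: **`card_mul_exp_neg_le`** — the REPAIRED absorption `(LM)⁻⁴|X|·e^{−½δLκd_{k+1}(X)} ≤ c₁`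
  for `½δLκ ≥ 1`, which is all (2.41) needs (the factor is absorbed into O(1), not into 1).
* §4 **`norm_Ek1_le_of_ineq240`** — (2.40) ⇒ the (2.41) shape with the explicit constant `O(1) = O₁e^{2c₁}K₀c₁`;
  **`bound241_of_ineq240`** — hence `B13.Bound241 S c` (the tree's typed (2.41), SKELETON row `B13.Eq2.41`) as soon as
  `O₁e^{2c₁}K₀c₁ ≤ A₂` (`A₂` = the printed O(1) of (2.41) in `B13.Consts`); `bound241_of_ineq240_geometry` — the same
  with the inputs bundled as the polymer geometry `B13Resummation.Geometry` that the KP substitute consumes.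
  `rate_241` — the exponent bookkeeping `−(1 − 9δ)½Lκd = −(1 − 10δ)½Lκd − ½δLκd`.

MODEL / DIVERGENCE (cell DIVERGENCE.md D-b13.1, F5): abstract carriers; the cube geometry enters only through the two
typed inputs; nothing of the series beyond the displayed hypotheses is asserted.  No new named fact (D-0026): `Ineq240`
is the row's printed display as a `Prop` (hypothesis of §4), everything else is a theorem.  Value: the row's display
typed + the p. 21 passage (2.40) ⇒ (2.41) kernel-checked with a located print slip; NOT summit progress.
HOME `run/shared/lean/pub/lit-balaban/` (`lit-balaban-r10/ROWS-B13.md` row B13.Eq2.40).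
-/

open Finset

noncomputable section

namespace Literature.MathematicalPhysics.QuantumFieldTheory.Balaban1983to89.B13Ineq240

open Literature.MathematicalPhysics.QuantumFieldTheory.Balaban1983to89
open Literature.MathematicalPhysics.QuantumFieldTheory.Balaban1983to89.B13FamilySum

variable {Cube : Type*} [DecidableEq Cube]

/-! ## §1. (2.40) p. 21 as printed -/

/-- The summand of the last sum of **(2.40)** p. 21 [PDF 21]: `C₃ε₁ exp 5κ exp(−½δLκd_{k+1}(Z)) O(1) exp 2(LM)⁻⁴|Z|`
(`C₃` = the activity constant of Lemma 3 = `B13.Consts.C3act`; `O₁` = the printed O(1); `(cubes Z).card` = (LM)⁻⁴|Z|).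
[cite: Balaban1988RG2Cluster, (2.40) p.21] -/
def term240 (S : B13.StepData) (c : B13.Consts) (cubes : S.Dk1.Dom → Finset Cube) (O₁ : ℝ) (Z : S.Dk1.Dom) : ℝ :=
  c.C3act * c.ε₁ * Real.exp (5 * c.κ) * Real.exp (-(1 / 2 * c.δ * (c.L : ℝ) * c.κ * S.Dk1.dj Z)) * O₁ *
    Real.exp (2 * ((cubes Z).card : ℝ))

/-- *"The last sum"* of **(2.40)** p. 21: `Σ_{Z⊂X} C₃ε₁ exp 5κ exp(−½δLκd_{k+1}(Z)) O(1) exp 2(LM)⁻⁴|Z|`, the sum over the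
localization domains Z ∈ 𝐃_{k+1} contained in X (`B13FamilySum.inside univ cubes (cubes X)`).
[cite: Balaban1988RG2Cluster, (2.40) p.21] -/
def lastSum240 (S : B13.StepData) (c : B13.Consts) (cubes : S.Dk1.Dom → Finset Cube) (O₁ : ℝ) (X : S.Dk1.Dom) : ℝ :=
  ∑ Z ∈ inside Finset.univ cubes (cubes X), term240 S c cubes O₁ Z

/-- **(2.40)** p. 21 [PDF 21], verbatim: *"To the above sum we can repeat all the considerations and bounds of the paper
[26], for κ sufficiently large, and ε₁ sufficiently small. We obtain* `|𝐄^{(k+1)}(X)| ≦ exp(−(1 − 9δ)½Lκd_{k+1}(X))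
exp(−5κ) · Σ_{Z⊂X} C₃ε₁ exp 5κ exp(−½δLκd_{k+1}(Z)) O(1) exp 2(LM)⁻⁴|Z|. (2.40)"* — AS PRINTED, on the space
Uᶜ_{k+1}(X, α₀, α₁) (`S.sp2 X`, as (2.41) = `B13.Bound241`), for the abstract step data `S` with footprints `cubes` and
the printed O(1) =: `O₁`.  The derivation (2.39) ⇒ (2.40) is BY REFERENCE to [26] (Cammarota 1982) and is not
reproduced (kernel substitute: `B13Resummation`, Kotecký–Preiss). [cite: Balaban1988RG2Cluster, (2.40) p.21] -/
def Ineq240 (S : B13.StepData) (c : B13.Consts) (cubes : S.Dk1.Dom → Finset Cube) (O₁ : ℝ) : Prop :=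
  ∀ X φ, φ ∈ S.sp2 X → ‖S.Ek1 X φ‖ ≤
    Real.exp (-((1 - 9 * c.δ) * ((c.L : ℝ) / 2) * c.κ * S.Dk1.dj X)) * Real.exp (-(5 * c.κ)) *
      lastSum240 S c cubes O₁ X

/-! ## §2. "The last sum is bounded by C₃ε₁ exp 5κ O(1)(LM)⁻⁴|X|" -/

section LastSum

variable {S : B13.StepData} {c : B13.Consts} {cubes : S.Dk1.Dom → Finset Cube} {O₁ κ₀ K₀ c₁ : ℝ}

omit [DecidableEq Cube] in
/-- One summand of (2.40) against the volume law (2.30) (repaired, `VolBound`: (LM)⁻⁴|Z| ≤ c₁(1 + d_{k+1}(Z))):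
`e^{2(LM)⁻⁴|Z|} ≤ e^{2c₁}·e^{2c₁d_{k+1}(Z)}`, so the summand is ≤ `C₃ε₁e^{5κ}·O₁e^{2c₁}·e^{−(½δLκ − 2c₁)d_{k+1}(Z)}`.
[cite: Balaban1988RG2Cluster, (2.40) p.21] -/
theorem term240_le (hvol : VolBound Finset.univ cubes S.Dk1.dj c₁) (hO : 0 ≤ O₁) (hCε : 0 ≤ c.C3act * c.ε₁)
    (Z : S.Dk1.Dom) :
    term240 S c cubes O₁ Z ≤ c.C3act * c.ε₁ * Real.exp (5 * c.κ) * (O₁ * Real.exp (2 * c₁)) *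
      Real.exp (-((1 / 2 * c.δ * (c.L : ℝ) * c.κ - 2 * c₁) * S.Dk1.dj Z)) := by
  have hZ : ((cubes Z).card : ℝ) ≤ c₁ * (1 + S.Dk1.dj Z) := hvol Z (Finset.mem_univ Z)
  have hexp : Real.exp (2 * ((cubes Z).card : ℝ)) ≤ Real.exp (2 * c₁) * Real.exp (2 * c₁ * S.Dk1.dj Z) := by
    rw [← Real.exp_add]
    exact Real.exp_le_exp.mpr (by nlinarith)
  have hpre : 0 ≤ c.C3act * c.ε₁ * Real.exp (5 * c.κ) *
      Real.exp (-(1 / 2 * c.δ * (c.L : ℝ) * c.κ * S.Dk1.dj Z)) * O₁ := by positivity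
  calc term240 S c cubes O₁ Z
      = c.C3act * c.ε₁ * Real.exp (5 * c.κ) * Real.exp (-(1 / 2 * c.δ * (c.L : ℝ) * c.κ * S.Dk1.dj Z)) * O₁ *
          Real.exp (2 * ((cubes Z).card : ℝ)) := rfl
    _ ≤ c.C3act * c.ε₁ * Real.exp (5 * c.κ) * Real.exp (-(1 / 2 * c.δ * (c.L : ℝ) * c.κ * S.Dk1.dj Z)) * O₁ *
          (Real.exp (2 * c₁) * Real.exp (2 * c₁ * S.Dk1.dj Z)) := mul_le_mul_of_nonneg_left hexp hpre
    _ = c.C3act * c.ε₁ * Real.exp (5 * c.κ) * (O₁ * Real.exp (2 * c₁)) *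
          (Real.exp (-(1 / 2 * c.δ * (c.L : ℝ) * c.κ * S.Dk1.dj Z)) * Real.exp (2 * c₁ * S.Dk1.dj Z)) := by ring
    _ = c.C3act * c.ε₁ * Real.exp (5 * c.κ) * (O₁ * Real.exp (2 * c₁)) *
          Real.exp (-((1 / 2 * c.δ * (c.L : ℝ) * c.κ - 2 * c₁) * S.Dk1.dj Z)) := by
        rw [← Real.exp_add]; congr 1; ring

/-- The anchored sum of the (2.40)-summands over the domains containing a fixed LM-cube □, by (1.26) p. 8 at scale k + 1
(`Ineq126`: Σ_{Z∋□} e^{−κ₀d_{k+1}(Z)} ≤ K₀) — *"for κ sufficiently large"* made explicit as `κ₀ + 2c₁ ≤ ½δLκ`: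
Σ_{Z∋□} (summand) ≤ `C₃ε₁e^{5κ}·(O₁e^{2c₁}K₀)`. [cite: Balaban1988RG2Cluster, (2.40) p.21] -/
theorem anchoredSum240_le (h126 : Ineq126 Finset.univ cubes S.Dk1.dj κ₀ K₀)
    (hvol : VolBound Finset.univ cubes S.Dk1.dj c₁) (hκ : κ₀ + 2 * c₁ ≤ 1 / 2 * c.δ * (c.L : ℝ) * c.κ)
    (hO : 0 ≤ O₁) (hCε : 0 ≤ c.C3act * c.ε₁) (q : Cube) :
    ∑ Z ∈ Finset.univ.filter (fun Z => q ∈ cubes Z), term240 S c cubes O₁ Z ≤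
      c.C3act * c.ε₁ * Real.exp (5 * c.κ) * (O₁ * Real.exp (2 * c₁) * K₀) := by
  set A : ℝ := c.C3act * c.ε₁ * Real.exp (5 * c.κ) * (O₁ * Real.exp (2 * c₁)) with hA
  have hA0 : 0 ≤ A := by positivity
  have hstep : ∀ Z, term240 S c cubes O₁ Z ≤ A * Real.exp (-(κ₀ * S.Dk1.dj Z)) := by
    intro Z
    refine (term240_le hvol hO hCε Z).trans ?_
    refine mul_le_mul_of_nonneg_left (Real.exp_le_exp.mpr ?_) hA0
    have hd : 0 ≤ S.Dk1.dj Z := S.Dk1.dj_nonneg Z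
    nlinarith
  calc ∑ Z ∈ Finset.univ.filter (fun Z => q ∈ cubes Z), term240 S c cubes O₁ Z
      ≤ ∑ Z ∈ Finset.univ.filter (fun Z => q ∈ cubes Z), A * Real.exp (-(κ₀ * S.Dk1.dj Z)) :=
        Finset.sum_le_sum fun Z _ => hstep Z
    _ = A * ∑ Z ∈ Finset.univ.filter (fun Z => q ∈ cubes Z), Real.exp (-(κ₀ * S.Dk1.dj Z)) := by
        rw [Finset.mul_sum]
    _ ≤ A * K₀ := mul_le_mul_of_nonneg_left (h126 q) hA0
    _ = c.C3act * c.ε₁ * Real.exp (5 * c.κ) * (O₁ * Real.exp (2 * c₁) * K₀) := by rw [hA]; ring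

/-- The counting step behind *"bounded by … (LM)⁻⁴|X|"*: every Z ⊂ X has a nonempty footprint inside that of X, so a
nonnegative function summed over the Z ⊂ X is at most its sum over the LM-cubes □ of X of the anchored sums over Z ∋ □.
[cite: Balaban1988RG2Cluster, (2.40) p.21] -/
theorem sum_inside_le_sum_anchored (hne : ∀ Z, (cubes Z).Nonempty) {g : S.Dk1.Dom → ℝ} (hg : ∀ Z, 0 ≤ g Z)
    (X : S.Dk1.Dom) :
    ∑ Z ∈ inside Finset.univ cubes (cubes X), g Z ≤
      ∑ q ∈ cubes X, ∑ Z ∈ Finset.univ.filter (fun Z => q ∈ cubes Z), g Z := by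
  classical
  have h1 : ∑ Z ∈ inside Finset.univ cubes (cubes X), g Z ≤
      ∑ Z ∈ inside Finset.univ cubes (cubes X), ∑ q ∈ cubes X, (if q ∈ cubes Z then g Z else 0) := by
    refine Finset.sum_le_sum fun Z hZ => ?_
    obtain ⟨q₀, hq₀⟩ := hne Z
    have hsub : cubes Z ⊆ cubes X := (mem_inside.mp hZ).2
    have hq₀X : q₀ ∈ cubes X := hsub hq₀
    calc g Z = (if q₀ ∈ cubes Z then g Z else 0) := by rw [if_pos hq₀]
      _ ≤ ∑ q ∈ cubes X, (if q ∈ cubes Z then g Z else 0) :=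
          Finset.single_le_sum (f := fun q => if q ∈ cubes Z then g Z else 0)
            (fun q _ => by split_ifs <;> simp [hg Z]) hq₀X
  refine h1.trans ?_
  rw [Finset.sum_comm]
  refine Finset.sum_le_sum fun q _ => ?_
  rw [← Finset.sum_filter]
  refine Finset.sum_le_sum_of_subset_of_nonneg ?_ (fun Z _ _ => hg Z)
  intro Z hZ
  simp only [Finset.mem_filter, Finset.mem_univ, true_and] at hZ ⊢
  exact hZ.2

/-- **p. 21 [PDF 21], first clause PROVED**: *"The last sum is bounded by C₃ε₁ exp 5κO(1)(LM)⁻⁴|X|"* — with the O(1)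
EXPLICIT, `O(1) = O₁·e^{2c₁}·K₀`, from (1.26) at scale k + 1 (`Ineq126`, rate κ₀, constant K₀), the repaired volume law
(2.30) (`VolBound`, constant c₁), nonempty footprints, and *"κ sufficiently large"* = `κ₀ + 2c₁ ≤ ½δLκ`.
[cite: Balaban1988RG2Cluster, (2.40)–(2.41) p.21] -/
theorem lastSum240_le (hne : ∀ Z, (cubes Z).Nonempty) (h126 : Ineq126 Finset.univ cubes S.Dk1.dj κ₀ K₀)
    (hvol : VolBound Finset.univ cubes S.Dk1.dj c₁) (hκ : κ₀ + 2 * c₁ ≤ 1 / 2 * c.δ * (c.L : ℝ) * c.κ)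
    (hO : 0 ≤ O₁) (hCε : 0 ≤ c.C3act * c.ε₁) (X : S.Dk1.Dom) :
    lastSum240 S c cubes O₁ X ≤
      c.C3act * c.ε₁ * Real.exp (5 * c.κ) * (O₁ * Real.exp (2 * c₁) * K₀) * ((cubes X).card : ℝ) := by
  have hg : ∀ Z, 0 ≤ term240 S c cubes O₁ Z := fun Z => by unfold term240; positivity
  calc lastSum240 S c cubes O₁ X
      ≤ ∑ q ∈ cubes X, ∑ Z ∈ Finset.univ.filter (fun Z => q ∈ cubes Z), term240 S c cubes O₁ Z :=
        sum_inside_le_sum_anchored hne hg X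
    _ ≤ ∑ _q ∈ cubes X, c.C3act * c.ε₁ * Real.exp (5 * c.κ) * (O₁ * Real.exp (2 * c₁) * K₀) :=
        Finset.sum_le_sum fun q _ => anchoredSum240_le h126 hvol hκ hO hCε q
    _ = c.C3act * c.ε₁ * Real.exp (5 * c.κ) * (O₁ * Real.exp (2 * c₁) * K₀) * ((cubes X).card : ℝ) := by
        rw [Finset.sum_const, nsmul_eq_mul]; ring

end LastSum

/-! ## §3. The absorption clause: as printed (fails at d_{k+1}(X) = 0) and repaired -/

section Absorb

variable {S : B13.StepData} {cubes : S.Dk1.Dom → Finset Cube} {c₁ a : ℝ}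

omit [DecidableEq Cube] in
/-- p. 21, the printed step *"(LM)⁻⁴|X| ≦ exp(LM)⁻⁴|X|"* (x ≤ eˣ). [cite: Balaban1988RG2Cluster, (2.40)–(2.41) p.21] -/
theorem card_le_exp_card (X : S.Dk1.Dom) : ((cubes X).card : ℝ) ≤ Real.exp ((cubes X).card : ℝ) := by
  have h := Real.add_one_le_exp ((cubes X).card : ℝ)
  linarith

omit [DecidableEq Cube] in
/-- **Located print slip** (the degenerate-domain phenomenon of cell GAPS G-B13-07 at this locus): the printed clause
*"the last exponential [exp(LM)⁻⁴|X|] multiplied by exp(−½δLκd_{k+1}(X)) is bounded by 1"* FAILS for every domain X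
with d_{k+1}(X) = 0 and a nonempty footprint (a single LM-cube): the product is `e^{(LM)⁻⁴|X|} ≥ e > 1`, whatever the
rate `a`.  Harmless for (2.41): see `card_mul_exp_neg_le`. [cite: Balaban1988RG2Cluster, (2.40)–(2.41) p.21] -/
theorem not_absorb_printed (X : S.Dk1.Dom) (hd : S.Dk1.dj X = 0) (hne : (cubes X).Nonempty) :
    ¬ (Real.exp ((cubes X).card : ℝ) * Real.exp (-(a * S.Dk1.dj X)) ≤ 1) := by
  intro h
  rw [hd, mul_zero, neg_zero, Real.exp_zero, mul_one] at h
  have hc : (1 : ℝ) ≤ ((cubes X).card : ℝ) := by exact_mod_cast hne.card_pos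
  have he : Real.exp 1 ≤ Real.exp ((cubes X).card : ℝ) := Real.exp_le_exp.mpr hc
  have h1 : (1 : ℝ) < Real.exp 1 := by
    have := Real.add_one_lt_exp (one_ne_zero : (1 : ℝ) ≠ 0); linarith
  linarith

omit [DecidableEq Cube] in
/-- **The repaired absorption** (what (2.41) actually needs): with the volume law (LM)⁻⁴|X| ≤ c₁(1 + d_{k+1}(X))
(`VolBound`, the repaired (2.30)) and a rate `a ≥ 1` (here a = ½δLκ, *"κ sufficiently large"*),
`(LM)⁻⁴|X| · e^{−a·d_{k+1}(X)} ≤ c₁` — the volume factor is absorbed into the O(1) of (2.41), not into 1.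
[cite: Balaban1988RG2Cluster, (2.40)–(2.41) p.21] -/
theorem card_mul_exp_neg_le (hvol : VolBound Finset.univ cubes S.Dk1.dj c₁) (hc₁ : 0 ≤ c₁) (ha : 1 ≤ a)
    (X : S.Dk1.Dom) : ((cubes X).card : ℝ) * Real.exp (-(a * S.Dk1.dj X)) ≤ c₁ := by
  have hd : 0 ≤ S.Dk1.dj X := S.Dk1.dj_nonneg X
  have hX : ((cubes X).card : ℝ) ≤ c₁ * (1 + S.Dk1.dj X) := hvol X (Finset.mem_univ X)
  have h1 : 1 + S.Dk1.dj X ≤ Real.exp (S.Dk1.dj X) := by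
    have := Real.add_one_le_exp (S.Dk1.dj X); linarith
  have h2 : Real.exp (S.Dk1.dj X) ≤ Real.exp (a * S.Dk1.dj X) := Real.exp_le_exp.mpr (by nlinarith)
  have hprod : Real.exp (a * S.Dk1.dj X) * Real.exp (-(a * S.Dk1.dj X)) = 1 := by
    rw [← Real.exp_add, add_neg_cancel, Real.exp_zero]
  have hpos : 0 ≤ Real.exp (-(a * S.Dk1.dj X)) := (Real.exp_pos _).le
  calc ((cubes X).card : ℝ) * Real.exp (-(a * S.Dk1.dj X))
      ≤ c₁ * (1 + S.Dk1.dj X) * Real.exp (-(a * S.Dk1.dj X)) := mul_le_mul_of_nonneg_right hX hpos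
    _ ≤ c₁ * Real.exp (a * S.Dk1.dj X) * Real.exp (-(a * S.Dk1.dj X)) := by
        refine mul_le_mul_of_nonneg_right (mul_le_mul_of_nonneg_left (h1.trans h2) hc₁) hpos
    _ = c₁ := by rw [mul_assoc, hprod, mul_one]

end Absorb

/-! ## §4. (2.40) ⇒ (2.41) -/

section To241

variable {S : B13.StepData} {c : B13.Consts} {cubes : S.Dk1.Dom → Finset Cube} {O₁ κ₀ K₀ c₁ : ℝ}

/-- The exponent bookkeeping of *"This yields (2.41)"*: `−(1 − 9δ)½Lκd = −(1 − 10δ)½Lκd − ½δLκd`.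
[cite: Balaban1988RG2Cluster, (2.41) p.21] -/
theorem rate_241 (c : B13.Consts) (d : ℝ) :
    -((1 - 9 * c.δ) * ((c.L : ℝ) / 2) * c.κ * d) =
      -((1 - 10 * c.δ) * ((c.L : ℝ) / 2) * c.κ * d) + -(1 / 2 * c.δ * (c.L : ℝ) * c.κ * d) := by
  ring

/-- **(2.40) ⇒ (2.41) with the O(1) explicit.**  From (2.40) as printed (`Ineq240`, printed O(1) = `O₁ ≥ 0`), the
geometric inputs (1.26) (`Ineq126`, κ₀, K₀) and repaired (2.30) (`VolBound`, c₁ ≥ 0) at scale k + 1, nonempty footprints,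
`C₃ε₁ ≥ 0`, and *"κ sufficiently large"* = `κ₀ + 2c₁ ≤ ½δLκ` and `1 ≤ ½δLκ`:
`|𝐄^{(k+1)}(X)| ≤ (O₁e^{2c₁}K₀c₁)·C₃ε₁·exp(−(1 − 10δ)½Lκd_{k+1}(X))` on Uᶜ_{k+1}(X, α₀, α₁) — the shape of (2.41) with
its printed O(1) = `O₁e^{2c₁}K₀c₁`. [cite: Balaban1988RG2Cluster, (2.40)–(2.41) p.21] -/
theorem norm_Ek1_le_of_ineq240 (h240 : Ineq240 S c cubes O₁) (hne : ∀ Z, (cubes Z).Nonempty)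
    (h126 : Ineq126 Finset.univ cubes S.Dk1.dj κ₀ K₀) (hvol : VolBound Finset.univ cubes S.Dk1.dj c₁)
    (hκ : κ₀ + 2 * c₁ ≤ 1 / 2 * c.δ * (c.L : ℝ) * c.κ) (hrate : 1 ≤ 1 / 2 * c.δ * (c.L : ℝ) * c.κ)
    (hO : 0 ≤ O₁) (hK : 0 ≤ K₀) (hc₁ : 0 ≤ c₁) (hCε : 0 ≤ c.C3act * c.ε₁)
    (X : S.Dk1.Dom) (φ : S.Φ) (hφ : φ ∈ S.sp2 X) :
    ‖S.Ek1 X φ‖ ≤ (O₁ * Real.exp (2 * c₁) * K₀ * c₁) * (c.C3act * c.ε₁) *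
      Real.exp (-((1 - 10 * c.δ) * ((c.L : ℝ) / 2) * c.κ * S.Dk1.dj X)) := by
  have h1 := h240 X φ hφ
  have hlast := lastSum240_le hne h126 hvol hκ hO hCε X
  have habs := card_mul_exp_neg_le hvol hc₁ hrate X
  set a : ℝ := 1 / 2 * c.δ * (c.L : ℝ) * c.κ with ha
  set r : ℝ := (1 - 10 * c.δ) * ((c.L : ℝ) / 2) * c.κ with hr
  set B : ℝ := c.C3act * c.ε₁ * Real.exp (5 * c.κ) * (O₁ * Real.exp (2 * c₁) * K₀) with hB
  have hB0 : 0 ≤ B := by positivity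
  have hsplit : Real.exp (-((1 - 9 * c.δ) * ((c.L : ℝ) / 2) * c.κ * S.Dk1.dj X)) =
      Real.exp (-(r * S.Dk1.dj X)) * Real.exp (-(a * S.Dk1.dj X)) := by
    rw [← Real.exp_add, rate_241]
  have hpre : 0 ≤ Real.exp (-((1 - 9 * c.δ) * ((c.L : ℝ) / 2) * c.κ * S.Dk1.dj X)) * Real.exp (-(5 * c.κ)) := by
    positivity
  have hfive : Real.exp (-(5 * c.κ)) * Real.exp (5 * c.κ) = 1 := by
    rw [← Real.exp_add, neg_add_cancel, Real.exp_zero]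
  calc ‖S.Ek1 X φ‖
      ≤ Real.exp (-((1 - 9 * c.δ) * ((c.L : ℝ) / 2) * c.κ * S.Dk1.dj X)) * Real.exp (-(5 * c.κ)) *
          lastSum240 S c cubes O₁ X := h1
    _ ≤ Real.exp (-((1 - 9 * c.δ) * ((c.L : ℝ) / 2) * c.κ * S.Dk1.dj X)) * Real.exp (-(5 * c.κ)) *
          (B * ((cubes X).card : ℝ)) := mul_le_mul_of_nonneg_left hlast hpre
    _ = (Real.exp (-(5 * c.κ)) * Real.exp (5 * c.κ)) * (c.C3act * c.ε₁) * (O₁ * Real.exp (2 * c₁) * K₀) *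
          Real.exp (-(r * S.Dk1.dj X)) * (((cubes X).card : ℝ) * Real.exp (-(a * S.Dk1.dj X))) := by
        rw [hsplit, hB]; ring
    _ = (c.C3act * c.ε₁) * (O₁ * Real.exp (2 * c₁) * K₀) * Real.exp (-(r * S.Dk1.dj X)) *
          (((cubes X).card : ℝ) * Real.exp (-(a * S.Dk1.dj X))) := by rw [hfive, one_mul]
    _ ≤ (c.C3act * c.ε₁) * (O₁ * Real.exp (2 * c₁) * K₀) * Real.exp (-(r * S.Dk1.dj X)) * c₁ := by
        refine mul_le_mul_of_nonneg_left habs ?_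
        positivity
    _ = (O₁ * Real.exp (2 * c₁) * K₀ * c₁) * (c.C3act * c.ε₁) * Real.exp (-(r * S.Dk1.dj X)) := by ring

/-- **(2.40) ⇒ (2.41) as typed in the tree** (`B13.Bound241 S c`: *"|𝐄^{(k+1)}(X)| ≦ O(1)C₃ε₁ exp(−(1 − 10δ)½Lκ
d_{k+1}(X))"*, SKELETON row `B13.Eq2.41`), as soon as the printed O(1) of (2.41) (`c.A₂`) dominates the explicit
constant: `O₁e^{2c₁}K₀c₁ ≤ A₂`. [cite: Balaban1988RG2Cluster, (2.40)–(2.41) p.21] -/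
theorem bound241_of_ineq240 (h240 : Ineq240 S c cubes O₁) (hne : ∀ Z, (cubes Z).Nonempty)
    (h126 : Ineq126 Finset.univ cubes S.Dk1.dj κ₀ K₀) (hvol : VolBound Finset.univ cubes S.Dk1.dj c₁)
    (hκ : κ₀ + 2 * c₁ ≤ 1 / 2 * c.δ * (c.L : ℝ) * c.κ) (hrate : 1 ≤ 1 / 2 * c.δ * (c.L : ℝ) * c.κ)
    (hO : 0 ≤ O₁) (hK : 0 ≤ K₀) (hc₁ : 0 ≤ c₁) (hCε : 0 ≤ c.C3act * c.ε₁)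
    (hA₂ : O₁ * Real.exp (2 * c₁) * K₀ * c₁ ≤ c.A₂) : B13.Bound241 S c := by
  intro X φ hφ
  have h := norm_Ek1_le_of_ineq240 h240 hne h126 hvol hκ hrate hO hK hc₁ hCε X φ hφ
  refine h.trans ?_
  have hfac : 0 ≤ (c.C3act * c.ε₁) *
      Real.exp (-((1 - 10 * c.δ) * ((c.L : ℝ) / 2) * c.κ * S.Dk1.dj X)) := by positivity
  calc (O₁ * Real.exp (2 * c₁) * K₀ * c₁) * (c.C3act * c.ε₁) *
        Real.exp (-((1 - 10 * c.δ) * ((c.L : ℝ) / 2) * c.κ * S.Dk1.dj X))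
      = (O₁ * Real.exp (2 * c₁) * K₀ * c₁) * ((c.C3act * c.ε₁) *
          Real.exp (-((1 - 10 * c.δ) * ((c.L : ℝ) / 2) * c.κ * S.Dk1.dj X))) := by ring
    _ ≤ c.A₂ * ((c.C3act * c.ε₁) *
          Real.exp (-((1 - 10 * c.δ) * ((c.L : ℝ) / 2) * c.κ * S.Dk1.dj X))) :=
        mul_le_mul_of_nonneg_right hA₂ hfac
    _ = c.A₂ * c.C3act * c.ε₁ * Real.exp (-((1 - 10 * c.δ) * ((c.L : ℝ) / 2) * c.κ * S.Dk1.dj X)) := by ring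

/-- The same with the inputs bundled as the polymer geometry of 𝐃_{k+1} that the tree's Kotecký–Preiss substitute for the
[26]-step consumes (`B13Resummation.Geometry`: footprints, (1.26) with κ₀/K₀, the volume law with c₁, nonnegativity):
(2.40) for its footprints ⇒ (2.41), under `κ₀ + 2c₁ ≤ ½δLκ`, `1 ≤ ½δLκ`, `C₃ε₁ ≥ 0`, `O₁ ≥ 0`, `O₁e^{2c₁}K₀c₁ ≤ A₂`.
[cite: Balaban1988RG2Cluster, (2.40)–(2.41) p.21] -/
theorem bound241_of_ineq240_geometry {Cube : Type} [DecidableEq Cube] (G : B13Resummation.Geometry S.Dk1 Cube)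
    {O₁ : ℝ} (h240 : Ineq240 S c G.cubes O₁)
    (hκ : G.κ₀ + 2 * G.c₁ ≤ 1 / 2 * c.δ * (c.L : ℝ) * c.κ) (hrate : 1 ≤ 1 / 2 * c.δ * (c.L : ℝ) * c.κ)
    (hO : 0 ≤ O₁) (hCε : 0 ≤ c.C3act * c.ε₁) (hA₂ : O₁ * Real.exp (2 * G.c₁) * G.K₀ * G.c₁ ≤ c.A₂) :
    B13.Bound241 S c :=
  bound241_of_ineq240 h240 G.cubes_nonempty G.ineq126 G.volBound hκ hrate hO G.K₀_nonneg G.c₁_nonneg hCε hA₂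

end To241

end Literature.MathematicalPhysics.QuantumFieldTheory.Balaban1983to89.B13Ineq240

end
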